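import Summits.BirchSwinnertonDyer.BirchSwinnertonDyer.Theorems.SchneiderFreeAdditiveX3AnticycControlAdditivePtSurjAnyTorsion
import Summits.BirchSwinnertonDyer.BirchSwinnertonDyer.Theorems.SchneiderFreeAdditiveX3AnticycControlAdditiveBaseCountFiniteAnyTorsion
import Summits.BirchSwinnertonDyer.BirchSwinnertonDyer.Theorems.SchneiderFreeAdditiveX3AnticycControlAdditiveCoinvAnyTorsion
import Summits.BirchSwinnertonDyer.BirchSwinnertonDyer.Theorems.SchneiderFreeAdditiveX3PoitouTateSelmerDualityHolds
import HarnessLib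

/-!
# Crux `AnticycControlAdditiveK` (route `SchneiderFreeAdditiveX3`, item stmt-BirchSwinnertonDyer-19295):
# the registered stub `stub_ptSurj` (P9-𝓒) under the crux's Kolyvagin antecedent ONLY, and the aside `stub_coinv` (L10)
# modulo PT (ii) — Poitou–Tate duality for Selmer structures now being a TREE THEOREM

Cell `bsd-schneider-ideate`, seat `bsd-schneider-door-c6` (prover, generation 18).  PARTITION: board row B6 ∩ X3 ∩ sst-twist,
`r = 1`, of `Rank1Residual.partition` — CONTROL corner (crux `AnticycControlAdditiveK`, skeleton v3-K c0242a50; facts binder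
`ControlFacts` (i) = `poitouTate_selmerStructure_duality`, (ii) = `poitouTate_sha_tateDual`).  bears_on: K1-door (r1, B6∩X3-sst)
(route-BirchSwinnertonDyer-SchneiderFreeAdditiveX3 item 18969 → 19295).

Poitou–Tate duality for Selmer structures (Milne *ADT* I Thm. 4.10(b) / Howard 2004 Thm. 2.1.11) is the tree theorem
`PoitouTateReduction.poitouTate_selmerStructure_duality_holds` (door-c4 gen 18, `…PoitouTateSelmerDualityHolds.lean`, on the
cell's Route A: Tate duality for the idèle class formation + the presentation road; doors c4/c5/c6).  This file discharges it
in door-c6 gen 5's reductions of the two remaining registered stubs that are NOT closed verbatim: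

* **`stub_ptSurj_of_kolyvagin`** — the registered `stub_ptSurj` signature VERBATIM, under the crux's own antecedent
  `∀ N W K, kolyvagin N W K` and NOTHING ELSE (`stub_ptSurj_of_facts`, its finiteness input from the antecedent by
  `finite_selmerAcBase_of_rankOne_anyTorsion`).  The registered signature of `stub_ptSurj` (unlike
  its sibling `stub_baseCountTors`) does not carry that antecedent; the finiteness of `Sel_𝔭̄(K, E[p^∞])` that (P9-𝓒) consumes is
  Kolyvagin's theorem (rank `E(K) = 1`, `#Ш(E/K)[p^∞] < ∞` from the non-torsion Heegner point), cite-only in the tree — so this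
  is the strongest in-tree form (stub-misstated note filed on the item: corrected signature = the Kolyvagin prefix).
* **`stub_coinv_of_poitouTate_sha`** — the aside `stub_coinv` (L10, coinvariants) modulo PT (ii) and the Kolyvagin antecedent
  (`stub_coinv_of_poitouTate`).

HONEST FRAMING: conditional results (hypotheses BY NAME: the cite-only `kolyvagin`, resp. PT (ii)); the registered stub
`stub_baseCountTors` and the crux modulo PT (ii) are door-c4 gen 18's `…AnticycControlAdditiveKStubBaseCountTors.lean`; BSD is
not proved by any of this.

References: [JetchevSkinnerWan2017] Prop. 3.3.2, Prop. 3.2.1, Lemma 3.3.3 (arXiv:1512.06894 pp. 10–12); [MilneADT2006] I Thm.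
4.10; [Howard2004HeegnerKolyvagin] Thm. 2.1.11; [Gross1991] Thm. 1.3 (Kolyvagin).
-/

noncomputable section

open scoped Classical

open Field NumberField IsDedekindDomain WeierstrassCurve
open Literature.NumberTheory.EllipticCurves Literature.NumberTheory.EllipticCurves.GreenbergSelmer
open Literature.NumberTheory.GaloisRepresentations
open Literature.NumberTheory.GaloisCohomology
open Literature.NumberTheory.EllipticCurves.ModularForms
  Literature.NumberTheory.EllipticCurves.Rank1Residual
  Literature.NumberTheory.EllipticCurves.Rank1Residual.Typed
  Summit.BirchSwinnertonDyer.Rank1Residual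
  Summit.BirchSwinnertonDyer.Rank1Residual.X11b
  Summit.BirchSwinnertonDyer.Rank1Residual.X11b.AcSelmer
  Summit.BirchSwinnertonDyer.Rank1Residual.X11b.LocBridge

set_option linter.dupNamespace false

namespace Summit.BirchSwinnertonDyer.BirchSwinnertonDyer.Theorems.SchneiderFreeAdditiveX3

open Summit.BirchSwinnertonDyer.BirchSwinnertonDyer.Theses.SchneiderFreeAdditiveX3
  Summit.BirchSwinnertonDyer.BirchSwinnertonDyer.Theorems.SchneiderFree
  Summit.BirchSwinnertonDyer.BirchSwinnertonDyer.Theorems.SchneiderFreeControlAtoms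

/-- **The registered stub `stub_ptSurj` of crux `AnticycControlAdditiveK` (skeleton v3-K c0242a50, item
stmt-BirchSwinnertonDyer-19295) UNDER THE CRUX'S OWN KOLYVAGIN ANTECEDENT — nothing else**: at every B6 frame, the
Poitou–Tate surjectivity (P9-𝓒) `H¹(K, E[p^∞]) ↠ ⊕_{v ∈ Σ ∪ {𝔭}} H¹(K_v)/localKer` onto the tower-local kernels with control away
from `Σ ∪ {𝔭}` (JSW17 Prop. 3.3.2, "reversing the roles of `v` and `v̄`").  This is door-c6 gen 5's `stub_ptSurj_of_poitouTate`
with its Poitou–Tate antecedent DISCHARGED by the tree theorem `PoitouTateReduction.poitouTate_selmerStructure_duality_holds`; the remaining hypothesis is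
the cite-only `kolyvagin` (rank `E(K) = 1`, `#Ш(E/K)[p^∞] < ∞` from the non-torsion Heegner point), which the crux decl
`AnticycControlAdditiveK` carries as its antecedent but the registered `stub_ptSurj` signature does not: VERBATIM the stub is
therefore exactly `(∀ N W K, kolyvagin N W K) → stub_ptSurj`, proved here (the finiteness of `Sel_𝔭̄(K, E[p^∞])` it consumes is not
available in-tree from the frame data without the rank-one input — door-c6 gen 5 finding).  HONEST FRAMING: conditional on the
cite-only Kolyvagin theorem exactly as the crux is; BSD is not proved by this.
[cite: JetchevSkinnerWan2017, Prop. 3.3.2 and Prop. 3.2.1 (arXiv:1512.06894 pp. 10–11)] [cite: MilneADT2006, Ch. I, Thm. 4.10(b)]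
[cite: Gross1991, Thm. 1.3] -/
theorem stub_ptSurj_of_kolyvagin
    (hKo : ∀ (N : ℕ) [NeZero N] (W : WeierstrassCurve ℚ) (K : Type) [Field K] [NumberField K],
      Literature.NumberTheory.EllipticCurves.kolyvagin N W K) :
    ∀ (W : WeierstrassCurve ℚ) [W.IsElliptic] [W.IsGloballyMinimal] (p : ℕ) [Fact p.Prime],
      W.analyticRank = 1 → p ≠ 2 → ClassX3 W p → Additive.SubSemistableTwist W p →
      ∀ (N : ℕ) [NeZero N] (K : Type) [Field K] [NumberField K]
        (Dt : ModularParametrizationData W N) (H : HeegnerDatum N (NumberField.discr K)) (ι : K →+* ℂ)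
        (P : (W.baseChange K).toAffine.Point),
        W.analyticRank = 1 → Additive.N10.Locus W p → W.conductorNorm ℤ = N →
        ∀ hK : IsImaginaryQuadratic K,
        Odd (NumberField.discr K) → ¬ p ∣ Units.torsionOrder K → SatisfiesHeegnerHypothesis N K →
        (W.quadraticTwist (NumberField.discr K : ℚ)).entireLFunction 1 ≠ 0 →
        WeierstrassCurve.Affine.Point.map ι.toRatAlgHom P = heegnerPointComplex Dt H →
        ¬ IsOfFinAddOrder P →
        ∀ (κ : ZpExtension K p), κ.IsAnticyclotomic →
          ∀ (γ : Field.absoluteGaloisGroup K) [Fact (κ.IsTopGenerator γ)]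
            (𝔭 : HeightOneSpectrum (𝓞 K)) (h𝔭 : ((p : ℕ) : 𝓞 K) ∈ 𝔭.asIdeal)
            (he : 𝔭.asIdeal.ramificationIdx (𝓞 ℚ) = 1) (hf : 𝔭.asIdeal.inertiaDeg (𝓞 ℚ) = 1),
            (∀ x : Π v : ↥(insert 𝔭 (nPlusPlaces_finite (W := W) (p := p) (K := K) hK.1).toFinset),
                  Literature.NumberTheory.EllipticCurves.subgroupH1
                    ((⊤ : Subgroup (absoluteGaloisGroup K)) ⊓ decomp (v : HeightOneSpectrum (𝓞 K)))
                    ((W.baseChange K).geomPrimaryTorsion p),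
                (∀ v : ↥(insert 𝔭 (nPlusPlaces_finite (W := W) (p := p) (K := K) hK.1).toFinset),
                  x v ∈ localKer κ.kerSubgroup ((W.baseChange K).geomPrimaryTorsion p)
                    (v : HeightOneSpectrum (𝓞 K))) →
                  ∃ c : (W.baseChange K).subgroupH1 p (⊤ : Subgroup (absoluteGaloisGroup K)),
                    locAtFinset (W.baseChange K) p _ c = x ∧
                    ∀ v : HeightOneSpectrum (𝓞 K), ((p : ℕ) : 𝓞 K) ∉ v.asIdeal → v ∉ (∅ : Set _) →
                      v ∉ insert 𝔭 (nPlusPlaces_finite (W := W) (p := p) (K := K) hK.1).toFinset →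
                        c ∈ awayKer ⊤ ((W.baseChange K).geomPrimaryTorsion p) v) :=
  -- `stub_ptSurj_of_facts` with (a) PT (i) := the tree theorem and (b) the finiteness of `Sel_𝔭(K, E[p^∞])` from the
  -- Kolyvagin antecedent (`finite_selmerAcBase_of_rankOne_anyTorsion`; route-independent imports only)
  stub_ptSurj_of_facts (fun K _ _ => PoitouTateReduction.poitouTate_selmerStructure_duality_holds (K := K))
    (fun hKo' => by
      intro W _ _ p _ _ _ _ _ N _ K _ _ Dt H ι P _ hloc hN hK _ _ hHe _ hP hnt κ _ γ _ 𝔭 h𝔭 he hf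
      have hpN : p ∣ W.conductorNorm ℤ := dvd_conductorNorm_of_n10Locus hloc
      have hsplit : SplitsIn K p := splitsIn_of_satisfiesHeegnerHypothesis hN hHe hpN
      obtain ⟨hrank, hSha⟩ := hKo' N W K hK hHe ⟨Dt, H, ι, hP⟩ hnt
      exact finite_selmerAcBase_of_rankOne_anyTorsion W p K
        (poitouTate_sum_localTatePairing_eq_zero_of_selmerStructure_duality
          (PoitouTateReduction.poitouTate_selmerStructure_duality_holds (K := K))) hK hsplit hrank hSha 𝔭 h𝔭 he hf)
    hKo


/-- **The aside `stub_coinv` (L10, coinvariants of `E(K_∞^{ac})[p^∞]`) modulo PT (ii) and the crux's Kolyvagin antecedent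
only** (door-c6 gen 5's `stub_coinv_of_poitouTate` with PT (i) discharged by `poitouTate_selmerStructure_duality_holds`).  CONDITIONAL; BSD is not proved
by this. [cite: JetchevSkinnerWan2017, Lemma 3.3.3 (arXiv:1512.06894 p. 12)] [cite: MilneADT2006, Ch. I, Thm. 4.10(a),(b)] -/
theorem stub_coinv_of_poitouTate_sha
    (hPT2 : ∀ (K : Type) [Field K] [NumberField K], poitouTate_sha_tateDual K)
    (hKo : ∀ (N : ℕ) [NeZero N] (W : WeierstrassCurve ℚ) (K : Type) [Field K] [NumberField K],
      Literature.NumberTheory.EllipticCurves.kolyvagin N W K) :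
    ∀ (W : WeierstrassCurve ℚ) [W.IsElliptic] [W.IsGloballyMinimal] (p : ℕ) [Fact p.Prime],
      W.analyticRank = 1 → p ≠ 2 → ClassX3 W p → Additive.SubSemistableTwist W p →
      ∀ (N : ℕ) [NeZero N] (K : Type) [Field K] [NumberField K]
        (Dt : ModularParametrizationData W N) (H : HeegnerDatum N (NumberField.discr K)) (ι : K →+* ℂ)
        (P : (W.baseChange K).toAffine.Point),
        W.analyticRank = 1 → Additive.N10.Locus W p → W.conductorNorm ℤ = N →
        ∀ hK : IsImaginaryQuadratic K,
        Odd (NumberField.discr K) → ¬ p ∣ Units.torsionOrder K → SatisfiesHeegnerHypothesis N K →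
        (W.quadraticTwist (NumberField.discr K : ℚ)).entireLFunction 1 ≠ 0 →
        WeierstrassCurve.Affine.Point.map ι.toRatAlgHom P = heegnerPointComplex Dt H →
        ¬ IsOfFinAddOrder P →
        ∀ (κ : ZpExtension K p), κ.IsAnticyclotomic →
          ∀ (γ : Field.absoluteGaloisGroup K) [Fact (κ.IsTopGenerator γ)]
            (𝔭 : HeightOneSpectrum (𝓞 K)) (h𝔭 : ((p : ℕ) : 𝓞 K) ∈ 𝔭.asIdeal)
            (he : 𝔭.asIdeal.ramificationIdx (𝓞 ℚ) = 1) (hf : 𝔭.asIdeal.inertiaDeg (𝓞 ℚ) = 1),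
            X11b.CoinvariantsTrivialAt (W.baseChange K) p κ 𝔭 γ
 :=
  stub_coinv_of_poitouTate (fun K _ _ => PoitouTateReduction.poitouTate_selmerStructure_duality_holds (K := K)) hPT2 hKo

end Summit.BirchSwinnertonDyer.BirchSwinnertonDyer.Theorems.SchneiderFreeAdditiveX3

end
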